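import Literature.NumberTheory.EllipticCurves.YanZhu2026.CyclotomicBDPCorollaryAtTrivialCharacter
import Summits.BirchSwinnertonDyer.Rank1Residual.Partition.MainConjecturesIrreducibleBDPThree
import HarnessLib

/-!
# The (IMC∘BDP)ᵍ link of the irreducible rank-one rows at every ODD good ordinary `p` — in particular
# `p = 3` — RE-KEYED from the arXiv-v2-worded input `h412` (Yan–Zhu Thm. 4.12 ∘ CGLS 5.1.3, A198;
# its (Im)-integral clause is PRE-dependent in the refereed text) to the PUBLISHED re-sourcing
# `h54 = YanZhu2026.cor54_prop342_thm513_generator_constantCoeff` (Yan–Zhu J. Algebra 2026 Cor. 5.4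
# ∘ Prop. 3.14 ∘ CGS Math. Ann. 2025 Prop. 3.4.2 ∘ CGLS 2022 Thm. 5.1.3 — v4's own proof of Thm. 5.11)

HONEST FRAMING (cell `b2b-bsdres`, run/shared/lean/b2b/bsd-rank1-residual/; page 1 of every file):
the goal is to DELETE the COMBINATION-SHAPED residual classes — to produce a Lean theorem "BSD_p
formula for every rank `≤ 1` curve in class `C`" assembled STRICTLY from published theorems — so
that the remainder becomes exactly the CONSTRUCTION-SHAPED classes, which are TYPED, not attempted;
this is not "finishing BSD". Every published theorem enters as one of the tree's existing named
Literature facts `(h : <Fact>)` (a `def … : Prop` vendored with its cite, D-0014; nothing asserted, no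
new fact, no `sorry`). Unit `b2b-bsdres-lit-glue` (GLUE seat), gen 12, sized ask A21 of
`HOME/b2b-bsdres-lit-glue/GLUE.md` §G12.2 — the Summits companion of the new Literature fact
`YanZhu2026.cor54_prop342_thm513_generator_constantCoeff` (p358701), answering
`HOME/b2b-bsdres-lit-glue/WAKE-T2-A198.md` (lit GEN 98 `DRIFT-READS.md` §F1; referee 2 R2-131.8).

## Why (the drift, in one paragraph)

`Partition/MainConjecturesIrreducibleBDPThree.lean` (gen 7) feeds the anticyclotomic main-conjecture
link (IMC∘BDP)ᵍ of the covered irreducible rank-one rows at `p = 3` (and the ordinary branch of row C3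
at every prime) from `h412 : thm412_thm513_generator_constantCoeff` — Yan–Zhu's BDP main conjecture
"integral under (Im)" AS WORDED IN arXiv v2 (Thm. 4.12). In the refereed text (arXiv v4 = J. Algebra
693 (2026)) that theorem is Thm. 5.7 and its integral clause is printed under FULL `p`-adic image of
`G_K`, the (Im) weakening being Remark 5.10 "via [BSTW, Prop. 12.7]" (a preprint): every consumer of
`h412` is CONDITIONAL ON A PREPRINT until re-keyed (cell ruling R2-131.8). The refereed text proves its
own rank-one `p`-part of BSD (Thm. 5.11) differently: "from the integral part of Corollary 5.4 [the
CYCLOTOMIC analogue of the BDP main conjecture, integral under (Im)], [CGS, Proposition 3.4.2]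
[`𝓕_Gr(E/K_∞⁺)(0) ∼_p 𝓕_Gr(E/K_∞⁻)(0)`], the fact that `𝓛_p^Gr(E/K)⁺(1) = 𝓛_p^Gr(E/K)⁻(1) ≠ 0`, and
the descent arguments in [JSW]". That chain minus the descent is the Literature fact `h54 :
cor54_prop342_thm513_generator_constantCoeff` (same conclusion as `h412` — a generator `F` of
`ch_Λ(𝒳_{𝓕_Gr}(E/K_∞⁻))` with `F(0) = u · c_E⁻²(1 − a_p p⁻¹ + p⁻¹)² log_{ω_E}(P_K)²`, `u ∈ ℤ_p^×` — under
three more binders: `rank_ℤ E(K) = 1`, `#Ш(E/K)[p^∞] < ∞`, `P_K` of infinite order). This file is the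
gen-7 file RE-KEYED to `h54`, theorem for theorem: the three extra binders are exactly `hrk`, `hfinp`,
`hPinf`, already in scope at every adapter (they are the hypotheses of the control fact JSW Thm. 3.3.1,
and at a classical Heegner datum they come from Kolyvagin, `hKo`). Nothing else changes; the gen-7
theorems stay (kernel-valid conditionals on `h412`).

## Contents (each the `h54`-twin of the gen-7 theorem of the same name with `thm412 ↦ cor54`)

* §1 `X11b.imcWaldspurgerOnTreeGoodAt_of_cor54` — (IMC∘BDP)ᵍ in the CGLS letter
  `IMCWaldspurgerOnTreeGoodAt p κ v̄ γ ι P`, GIVEN one generator with `𝓕(0) ≠ 0`, in rank one;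
* §2 `…_of_cor54_of_thm331` — the generator from JSW 3.3.1 at THE embedding `embAt v̄`;
* §3 `X11b.imcWaldspurgerOnTreeGoodAt_inducedPlace_of_cor54_of_thm331` — the JSW letter
  `IMCWaldspurgerOnTreeGoodAt p κ (inducedPlace ι) γ ι P` (σ-bridge + S13) — THE adapter the
  identity-form rows (`MainConjecturesIrreducibleIdentityRows`, l.165) consume;
* §4 `imcLowerWaldspurgerOnTreeGoodAt[_inducedPlace]_of_heegner_of_cor54_of_thm331` — the `hLA`-shaped
  binders at a classical Heegner datum, DISCHARGED from published facts at every odd good ordinary `p`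
  with (Im) and (irr_K);
* §5 **`RowC16.bsdp_of_yzThm49_of_thm331_of_cor54`** (row C16 at `p = 3`, `r ≤ 1`) and
  **`RowC3.bsdp_of_thm331_of_bdpFacts_of_cor54_of_columnMainConjectures`** (row C3, ordinary branch at
  every prime of the row): the gen-7 class theorems with `h412 ↦ h54` — the printed proof of Yan–Zhu
  Thm. 5.11 (v4) at `p = 3`, kernel-checked at statement level, modulo `hIrrK` / `htam0` as in gen 7.

References: [YanZhu2026] Cor. 5.4, Prop. 3.14, Thm. 5.11 and its proof (arXiv:2412.20078v4 TeX
l.1166–1184, l.896–903, l.1347); [CastellaGrossiSkinner2025] Prop. 3.4.2; [CastellaGrossiLeeSkinner2022]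
Thm. 5.1.3; [JetchevSkinnerWan2017] Thm. 1.2.1, Thm. 3.3.1, §7.4.1; [Wuthrich2014] Lemma 20;
HOME/b2b-bsdres-lit-glue/GLUE.md GEN 12 §G12.0–G12.4.
-/

set_option autoImplicit false

noncomputable section

open scoped Classical

open WeierstrassCurve NumberField IsDedekindDomain Literature.NumberTheory.EllipticCurves
  Literature.NumberTheory.EllipticCurves.ModularForms Literature.NumberTheory.Automorphic
  Literature.NumberTheory.EllipticCurves.Rank1Residual
  Literature.NumberTheory.EllipticCurves.YanZhu2026
  Literature.NumberTheory.EllipticCurves.BurungaleCastellaSkinner2025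
  Literature.NumberTheory.EllipticCurves.BurungaleKobayashiOta2024
  Literature.NumberTheory.EllipticCurves.CastellaGrossiLeeSkinner2022
  Literature.NumberTheory.EllipticCurves.JetchevSkinnerWan2017
  Summit.BirchSwinnertonDyer.BirchSwinnertonDyer.Theorems.Rank1ResidualX1Defs

namespace Summit.BirchSwinnertonDyer.Rank1Residual

namespace X11b

/-! ### §1 `IMCWaldspurgerOnTreeGoodAt` (CGLS letter) from the re-sourced fact, given a generator -/

section IMC

variable {W : WeierstrassCurve ℚ} [W.IsElliptic] [W.IsGloballyMinimal] {p : ℕ} [Fact p.Prime]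
  {K : Type} [Field K] [NumberField K]

/-- **`X11b.IMCWaldspurgerOnTreeGoodAt p κ v̄ γ ι P` FROM Yan–Zhu 2026 Cor. 5.4 ∘ Prop. 3.14 ∘ CGS 2025
Prop. 3.4.2 ∘ CGLS 2022 Thm. 5.1.3** (`h54`), at every datum of the fact — `p ≥ 3` good ordinary with
(Im), `K` imaginary quadratic with (Heeg) for `N = N_E`, (spl), (disc) `D_K` odd `≠ −3`, `ρ̄_E|_{G_K}`
irreducible, `ι : K ↪ ℚ_p` inducing `v`, `v̄ ∋ p` the other (STRICT) prime, `κ` anticyclotomic with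
generator `γ`, `P = P_K` the Heegner point of `(Dt, H, ιC)`, IN RANK ONE (`rank_ℤ E(K) = 1`,
`#Ш(E/K)[p^∞] < ∞`, `P_K` of infinite order) — for a parametrisation with `p ∤ c_E`, GIVEN one
generator `G` of `ch_Λ(𝒳_{𝓕_Gr})` with `G(0) ≠ 0`. The `h54`-twin of gen 7's
`imcWaldspurgerOnTreeGoodAt_of_thm412`.
[cite: YanZhu2026, Cor. 5.4, Prop. 3.14 and the proof of Thm. 5.11 (arXiv:2412.20078v4 TeX l.1166–1184, l.896–903, l.1347)]
[cite: CastellaGrossiSkinner2025, Prop. 3.4.2] [cite: CastellaGrossiLeeSkinner2022, Thm. 5.1.3]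
[cite: Castella2018, §5 (eq:IMC+BDP) (arXiv:1704.06608 p. 12)] -/
theorem imcWaldspurgerOnTreeGoodAt_of_cor54 (h54 : cor54_prop342_thm513_generator_constantCoeff)
    (hp : 3 ≤ p) (hord : GoodOrd W p) (him : BigIm W p) (hK : IsImaginaryQuadratic K)
    (hodd : Odd (NumberField.discr K)) (h3 : NumberField.discr K ≠ -3)
    {N : ℕ} [NeZero N] (hN : W.conductorNorm ℤ = N) (hHN : SatisfiesHeegnerHypothesis N K)
    (hHp : SatisfiesHeegnerHypothesis p K) (hirrK : (W.baseChange K).HasIrreducibleModPGaloisRep p)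
    (ι : K →+* ℚ_[p]) (v vbar : HeightOneSpectrum (𝓞 K))
    (hv : ∀ x : 𝓞 K, x ∈ v.asIdeal ↔ ‖ι (x : K)‖ < 1)
    (hvbar : ((p : ℕ) : 𝓞 K) ∈ vbar.asIdeal) (hne : vbar ≠ v)
    (κ : ZpExtension K p) (hκ : κ.IsAnticyclotomic)
    (γ : Field.absoluteGaloisGroup K) [Fact (κ.IsTopGenerator γ)]
    (Dt : ModularParametrizationData W N) (hc : ¬ (p : ℤ) ∣ Dt.c)
    (H : HeegnerDatum N (NumberField.discr K)) (ιC : K →+* ℂ) (P : (W.baseChange K).toAffine.Point)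
    (hP : WeierstrassCurve.Affine.Point.map ιC.toRatAlgHom P = heegnerPointComplex Dt H)
    (hrk : (W.baseChange K).mordellWeilRank = 1)
    (hfinp : Finite (AddCommGroup.primaryComponent (W.baseChange K).sha p))
    (hPinf : ¬ IsOfFinAddOrder P)
    (G : IwasawaAlgebra p)
    (hG : Literature.NumberTheory.EllipticCurves.Castella2018.AcSelmer.XAc.charIdeal (W.baseChange K) p
      κ vbar ∅ γ = Ideal.span {G})
    (hG0 : PowerSeries.constantCoeff G ≠ 0) :
    IMCWaldspurgerOnTreeGoodAt p κ vbar γ ι P := by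
  have hHN' : SatisfiesHeegnerHypothesis (W.conductorNorm ℤ) K := by rw [hN]; exact hHN
  obtain ⟨n, hn, hval⟩ := hasCharValuationAt_of_cor54 h54 hp hord him K hK hHN' hHp hodd h3 hirrK ι
    v vbar hv hvbar hne κ hκ γ Dt H ιC P hP hrk hfinp hPinf G hG hG0
  have hc0 : padicValInt p Dt.c = 0 := padicValInt.eq_zero_of_not_dvd hc
  refine ⟨n, (AcSelmer.hasCharValuationAt_iff_literature _ p κ vbar ∅ γ n).mpr hn, ?_⟩
  rw [padicLogOrd_eq_literature]
  omega

/-! ### §2 The generator from the published control theorem (JSW 3.3.1, `p ≥ 3`) -/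

/-- **(IMC∘BDP)ᵍ, CGLS letter, from `h54` + JSW 3.3.1** — every odd good ordinary `p` with (Im) and
(irr_K), in rank one: the generator with `𝓕(0) ≠ 0` of `ch_Λ(X_ac)` for the module STRICT AT `v̄` comes
from Jetchev–Skinner–Wan 2017 Thm. 3.3.1 (A174, `p ≥ 3`) applied at THE embedding `embAt v̄`, under
the SAME three rank-one binders the re-sourced fact carries. The `h54`-twin of gen 7's
`imcWaldspurgerOnTreeGoodAt_of_thm412_of_thm331`.
[cite: YanZhu2026, Cor. 5.4 and the proof of Thm. 5.11] [cite: CastellaGrossiSkinner2025, Prop. 3.4.2]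
[cite: CastellaGrossiLeeSkinner2022, Thm. 5.1.3] [cite: JetchevSkinnerWan2017, Thm. 3.3.1] -/
theorem imcWaldspurgerOnTreeGoodAt_of_cor54_of_thm331 (h54 : cor54_prop342_thm513_generator_constantCoeff)
    (h331 : thm331_anticyclotomicControl)
    (hp : 3 ≤ p) (hord : GoodOrd W p) (him : BigIm W p)
    (hK : IsImaginaryQuadratic K) (hodd : Odd (NumberField.discr K)) (h3 : NumberField.discr K ≠ -3)
    {N : ℕ} [NeZero N] (hN : W.conductorNorm ℤ = N) (hHN : SatisfiesHeegnerHypothesis N K)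
    (hHp : SatisfiesHeegnerHypothesis p K) (hirrK : (W.baseChange K).HasIrreducibleModPGaloisRep p)
    (ι : K →+* ℚ_[p]) (v vbar : HeightOneSpectrum (𝓞 K))
    (hv : ∀ x : 𝓞 K, x ∈ v.asIdeal ↔ ‖ι (x : K)‖ < 1)
    (hvbar : ((p : ℕ) : 𝓞 K) ∈ vbar.asIdeal) (hne : vbar ≠ v)
    (κ : ZpExtension K p) (hκ : κ.IsAnticyclotomic)
    (γ : Field.absoluteGaloisGroup K) [Fact (κ.IsTopGenerator γ)]
    (Dt : ModularParametrizationData W N) (hc : ¬ (p : ℤ) ∣ Dt.c)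
    (H : HeegnerDatum N (NumberField.discr K)) (ιC : K →+* ℂ) (P : (W.baseChange K).toAffine.Point)
    (hP : WeierstrassCurve.Affine.Point.map ιC.toRatAlgHom P = heegnerPointComplex Dt H)
    (hrk : (W.baseChange K).mordellWeilRank = 1)
    (hfinp : Finite (AddCommGroup.primaryComponent (W.baseChange K).sha p))
    (hPinf : ¬ IsOfFinAddOrder P) :
    IMCWaldspurgerOnTreeGoodAt p κ vbar γ ι P := by
  have hHN' : SatisfiesHeegnerHypothesis (W.conductorNorm ℤ) K := by rw [hN]; exact hHN
  -- `v̄` has degree one (`p` splits in the quadratic `K`), so `embAt v̄ : K ↪ ℚ_p` induces `v̄`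
  have hsplit : SplitsIn K p := hHp p Fact.out (dvd_refl p)
  obtain ⟨he, hf⟩ := degreeOne_of_splitsIn hK.1 hsplit hvbar
  obtain ⟨-, F, hF, hF0, -⟩ := h331 W p hp hord.1 K hK hHp hHN' hirrK
    (embAt K p vbar hvbar he hf) vbar (mem_asIdeal_iff_norm_embAt_lt_one vbar hvbar he hf) κ hκ γ hrk
    hfinp P hPinf
  exact imcWaldspurgerOnTreeGoodAt_of_cor54 h54 hp hord him hK hodd h3 hN hHN hHp hirrK ι v vbar hv
    hvbar hne κ hκ γ Dt hc H ιC P hP hrk hfinp hPinf F hF hF0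

/-! ### §3 The JSW letter: module strict at the induced prime, log along the same embedding -/

/-- **(IMC∘BDP)ᵍ in the JSW / Castella letter `IMCWaldspurgerOnTreeGoodAt p κ (inducedPlace ι) γ ι P`
from `h54` + JSW 3.3.1**, for EVERY embedding `ι : K ↪ ℚ_p`, in rank one, at every odd good ordinary
`p` with (Im) and (irr_K): `v = inducedPlace ι`, `w ≠ v` the other prime above `p`; the re-sourced
fact at the embedding `embAt w`, strict prime `v`, gives the valuation of every generator of
`ch_Λ(X_ac(κ, v))` with non-zero constant term (one exists by JSW 3.3.1 at `(ι, v)`), and `embAt w = ι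
∘ σ` for an involution `σ` of `K` (`exists_involutive_comp_eq`) with `ord_p log_{embAt w} P = ord_p
log_ι P` in rank one (`padicLogOrd_comp_eq_of_rank_one`). The `h54`-twin of gen 7's
`imcWaldspurgerOnTreeGoodAt_inducedPlace_of_thm412_of_thm331` — the adapter consumed by
`MainConjecturesIrreducibleIdentityRows` (there with `h412`).
[cite: YanZhu2026, Cor. 5.4, Prop. 3.14 and the proof of Thm. 5.11 (arXiv:2412.20078v4 TeX l.1347)]
[cite: CastellaGrossiSkinner2025, Prop. 3.4.2] [cite: CastellaGrossiLeeSkinner2022, Thm. 5.1.3]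
[cite: JetchevSkinnerWan2017, Thm. 3.3.1, §2.3.2 (p. 7)] [cite: Castella2018, Thm. 2.3, §5 (eq:IMC+BDP)] -/
theorem imcWaldspurgerOnTreeGoodAt_inducedPlace_of_cor54_of_thm331
    (h54 : cor54_prop342_thm513_generator_constantCoeff) (h331 : thm331_anticyclotomicControl)
    (hp : 3 ≤ p) (hord : GoodOrd W p) (him : BigIm W p)
    (hK : IsImaginaryQuadratic K) (hodd : Odd (NumberField.discr K)) (h3 : NumberField.discr K ≠ -3)
    {N : ℕ} [NeZero N] (hN : W.conductorNorm ℤ = N) (hHN : SatisfiesHeegnerHypothesis N K)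
    (hHp : SatisfiesHeegnerHypothesis p K) (hirrK : (W.baseChange K).HasIrreducibleModPGaloisRep p)
    (ι : K →+* ℚ_[p]) (κ : ZpExtension K p) (hκ : κ.IsAnticyclotomic)
    (γ : Field.absoluteGaloisGroup K) [Fact (κ.IsTopGenerator γ)]
    (Dt : ModularParametrizationData W N) (hc : ¬ (p : ℤ) ∣ Dt.c)
    (H : HeegnerDatum N (NumberField.discr K)) (ιC : K →+* ℂ) (P : (W.baseChange K).toAffine.Point)
    (hP : WeierstrassCurve.Affine.Point.map ιC.toRatAlgHom P = heegnerPointComplex Dt H)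
    (hrk : (W.baseChange K).mordellWeilRank = 1)
    (hfinp : Finite (AddCommGroup.primaryComponent (W.baseChange K).sha p))
    (hPinf : ¬ IsOfFinAddOrder P) :
    IMCWaldspurgerOnTreeGoodAt p κ (inducedPlace ι) γ ι P := by
  have hHN' : SatisfiesHeegnerHypothesis (W.conductorNorm ℤ) K := by rw [hN]; exact hHN
  -- the other prime `w` above `p`, of degree one, and THE embedding at it
  obtain ⟨w, hw, hwne⟩ := exists_other_prime hHp (inducedPlace ι) (natCast_mem_inducedPlace ι)
  have hsplit : SplitsIn K p := hHp p Fact.out (dvd_refl p)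
  obtain ⟨he, hf⟩ := degreeOne_of_splitsIn hK.1 hsplit hw
  set ιw : K →+* ℚ_[p] := embAt K p w hw he hf with hιw
  -- a generator with non-zero constant term of the module strict at `v = inducedPlace ι`, from JSW
  obtain ⟨-, F, hF, hF0, -⟩ := h331 W p hp hord.1 K hK hHp hHN' hirrK ι (inducedPlace ι)
    (mem_inducedPlace_iff ι) κ hκ γ hrk hfinp P hPinf
  -- the re-sourced fact at the embedding `ιw` (inducing `w`), strict prime `inducedPlace ι`
  obtain ⟨n, hn, hval⟩ := hasCharValuationAt_of_cor54 h54 hp hord him K hK hHN' hHp hodd h3 hirrK ιw w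
    (inducedPlace ι) (mem_asIdeal_iff_norm_embAt_lt_one w hw he hf) (natCast_mem_inducedPlace ι)
    (fun h ↦ hwne h.symm) κ hκ γ Dt H ιC P hP hrk hfinp hPinf F hF hF0
  -- `ιw = ι ∘ σ` for an involution `σ`; the log valuations agree in rank one
  obtain ⟨σ, hσ, hισ⟩ := exists_involutive_comp_eq hK.1 ι ιw
  have hlog : Literature.NumberTheory.EllipticCurves.padicLogOrd W p ιw P = padicLogOrd W p ι P := by
    rw [← hισ, ← padicLogOrd_eq_literature]
    exact padicLogOrd_comp_eq_of_rank_one W p (by omega) σ hσ ι hrk P hPinf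
  have hc0 : padicValInt p Dt.c = 0 := padicValInt.eq_zero_of_not_dvd hc
  refine ⟨n, (AcSelmer.hasCharValuationAt_iff_literature _ p κ (inducedPlace ι) ∅ γ n).mpr hn, ?_⟩
  rw [hlog] at hval
  omega

end IMC

/-! ### §4 The `hLA`-shaped binders at a classical Heegner datum, DISCHARGED at every odd `p` -/

section Datum

variable (W : WeierstrassCurve ℚ) [W.IsElliptic] [W.IsGloballyMinimal] (p : ℕ) [Fact p.Prime]
  (N : ℕ) [NeZero N] (K : Type) [Field K] [NumberField K]
  (Dt : ModularParametrizationData W N) (H : HeegnerDatum N (NumberField.discr K)) (ιC : K →+* ℂ)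
  (P : (W.baseChange K).toAffine.Point)

/-- **The CGLS-letter binder `IMCLowerWaldspurgerOnTreeGoodAt p κ v̄ γ ι P` (gen 5's `hLA`) at a
classical Heegner datum with `P_K` non-torsion, from `h54` + JSW 3.3.1** — every odd good ordinary `p`
with (Im) and (irr_K): `rank_ℤ E(K) = 1` and `#Ш(E/K) < ∞` by Kolyvagin (`hKo`, from the non-torsion
Heegner point) — which also supply the re-sourced fact's rank-one binders; `d_K < −4` gives `d_K ≠ −3`.
The `h54`-twin of gen 7's `imcLowerWaldspurgerOnTreeGoodAt_of_heegner_of_thm412_of_thm331`.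
[cite: YanZhu2026, Cor. 5.4 and the proof of Thm. 5.11 (arXiv:2412.20078v4 TeX l.1347)]
[cite: CastellaGrossiSkinner2025, Prop. 3.4.2] [cite: CastellaGrossiLeeSkinner2022, Thm. 5.1.3]
[cite: JetchevSkinnerWan2017, Thm. 3.3.1] [cite: Kolyvagin1990, Thm. A] -/
theorem imcLowerWaldspurgerOnTreeGoodAt_of_heegner_of_cor54_of_thm331
    (h54 : cor54_prop342_thm513_generator_constantCoeff) (h331 : thm331_anticyclotomicControl)
    (hKo : kolyvagin N W K)
    (hp : 3 ≤ p) (hord : GoodOrd W p) (him : BigIm W p)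
    (hirrK : (W.baseChange K).HasIrreducibleModPGaloisRep p)
    (hN : W.conductorNorm ℤ = N) (hK : IsImaginaryQuadratic K)
    (hodd : Odd (NumberField.discr K)) (hlt : NumberField.discr K < -4)
    (hHN : SatisfiesHeegnerHypothesis N K) (hHp : SatisfiesHeegnerHypothesis p K)
    (hP : WeierstrassCurve.Affine.Point.map ιC.toRatAlgHom P = heegnerPointComplex Dt H)
    (hc : ¬ (p : ℤ) ∣ Dt.c) (hPinf : ¬ IsOfFinAddOrder P) {κ : ZpExtension K p} (hκ : κ.IsAnticyclotomic)
    {γ : Field.absoluteGaloisGroup K} [Fact (κ.IsTopGenerator γ)] (ι : K →+* ℚ_[p])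
    (vbar : HeightOneSpectrum (𝓞 K)) (hvbar : ((p : ℕ) : 𝓞 K) ∈ vbar.asIdeal)
    (hne : vbar ≠ inducedPlace ι) :
    IMCLowerWaldspurgerOnTreeGoodAt p κ vbar γ ι P := by
  obtain ⟨hrk, hsha⟩ := hKo hK hHN ⟨Dt, H, ιC, hP⟩ hPinf
  haveI : Finite (W.baseChange K).sha := hsha
  exact imcLowerWaldspurgerOnTreeGoodAt_of_imcWaldspurgerOnTreeGoodAt
    (imcWaldspurgerOnTreeGoodAt_of_cor54_of_thm331 h54 h331 hp hord him hK hodd (by omega) hN hHN hHp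
      hirrK ι (inducedPlace ι) vbar (mem_inducedPlace_iff ι) hvbar hne κ hκ γ Dt hc H ιC P hP hrk
      inferInstance hPinf)

/-- **The JSW-letter binder `IMCLowerWaldspurgerOnTreeGoodAt p κ (inducedPlace ι) γ ι P` (gen 6's
`hLA` / `hLA3` / `hLAle3`) at a classical Heegner datum with `P_K` non-torsion, from `h54` + JSW 3.3.1 +
the σ-bridge** — every odd good ordinary `p` with (Im) and (irr_K); rank one and finite `Ш` over `K`
by Kolyvagin (`hKo`). The `h54`-twin of gen 7's
`imcLowerWaldspurgerOnTreeGoodAt_inducedPlace_of_heegner_of_thm412_of_thm331`.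
[cite: YanZhu2026, Cor. 5.4 and the proof of Thm. 5.11 (arXiv:2412.20078v4 TeX l.1347)]
[cite: CastellaGrossiSkinner2025, Prop. 3.4.2] [cite: JetchevSkinnerWan2017, Thm. 3.3.1, §7.4.1]
[cite: Kolyvagin1990, Thm. A] -/
theorem imcLowerWaldspurgerOnTreeGoodAt_inducedPlace_of_heegner_of_cor54_of_thm331
    (h54 : cor54_prop342_thm513_generator_constantCoeff) (h331 : thm331_anticyclotomicControl)
    (hKo : kolyvagin N W K)
    (hp : 3 ≤ p) (hord : GoodOrd W p) (him : BigIm W p)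
    (hirrK : (W.baseChange K).HasIrreducibleModPGaloisRep p)
    (hN : W.conductorNorm ℤ = N) (hK : IsImaginaryQuadratic K)
    (hodd : Odd (NumberField.discr K)) (hlt : NumberField.discr K < -4)
    (hHN : SatisfiesHeegnerHypothesis N K) (hHp : SatisfiesHeegnerHypothesis p K)
    (hP : WeierstrassCurve.Affine.Point.map ιC.toRatAlgHom P = heegnerPointComplex Dt H)
    (hc : ¬ (p : ℤ) ∣ Dt.c) (hPinf : ¬ IsOfFinAddOrder P) {κ : ZpExtension K p} (hκ : κ.IsAnticyclotomic)
    {γ : Field.absoluteGaloisGroup K} [Fact (κ.IsTopGenerator γ)] (ι : K →+* ℚ_[p]) :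
    IMCLowerWaldspurgerOnTreeGoodAt p κ (inducedPlace ι) γ ι P := by
  obtain ⟨hrk, hsha⟩ := hKo hK hHN ⟨Dt, H, ιC, hP⟩ hPinf
  haveI : Finite (W.baseChange K).sha := hsha
  exact imcLowerWaldspurgerOnTreeGoodAt_of_imcWaldspurgerOnTreeGoodAt
    (imcWaldspurgerOnTreeGoodAt_inducedPlace_of_cor54_of_thm331 h54 h331 hp hord him hK hodd
      (by omega) hN hHN hHp hirrK ι κ hκ γ Dt hc H ιC P hP hrk inferInstance hPinf)

end Datum

end X11b

/-! ### §5 Rows C16 and C3 with BOTH anticyclotomic links published at `p = 3` — on `h54` -/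

section Rows

variable (W : WeierstrassCurve ℚ) [W.IsElliptic] [W.IsGloballyMinimal] (p : ℕ) [Fact p.Prime]

/-- **Row C16 (`r ≤ 1`: `p = 3` good ordinary, (irr), surj(3) ∨ ram(3)), anomalous or not, from
NAMED LITERATURE FACTS** (+ (irr_K) at the Heegner fields, + `3 ∤ ∏c_ℓ` in rank one): gen 6's
`RowC16.bsdp_of_yzThm49_of_thm331` with its last typed binder `hLA` DISCHARGED by the re-sourced
published fact `h54` (Yan–Zhu Cor. 5.4 ∘ Prop. 3.14 ∘ CGS Prop. 3.4.2 ∘ CGLS Thm. 5.1.3, §4; (Im) at `3`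
from surj(3) by Wuthrich 2014 Lemma 20 `hW20`, ram(3) ⇒ surj(3) by `surj_of_irr_of_ram`). Inputs:
Yan–Zhu Thm. 4.9 = v4 Thm. 5.2 (`hYZ`, cyclotomic IMC, integral under (Im)), JSW Thm. 3.3.1 (`h331`),
`h54`, Gross–Zagier, Kolyvagin, GZK, Greenberg 4.1, modularity, Hoffstein–Luo / BFH, Mazur (Manin),
Néron scaling, Wuthrich L. 20 — all named facts of the tree. This is the printed proof of Yan–Zhu
Thm. 5.11 (v4) at `p = 3` ("The `p`-part of the BSD formula in the rank zero case follows from the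
integral part of Theorem 5.2 … in the rank one case … from the integral part of Corollary 5.4, [CGS,
Proposition 3.4.2], the fact that `𝓛_p^Gr(E/K)⁺(1) = 𝓛_p^Gr(E/K)⁻(1) ≠ 0`, and the descent arguments
in [JSW]", v4 TeX l.1345–1347), kernel-checked at statement level. The `h54`-twin of gen 7's
`RowC16.bsdp_of_yzThm49_of_thm331_of_thm412`.
[cite: YanZhu2026, Thm. 5.2, Cor. 5.4, Thm. 5.11 and its proof (arXiv:2412.20078v4 TeX l.1345–1347)]
[cite: CastellaGrossiSkinner2025, Prop. 3.4.2] [cite: JetchevSkinnerWan2017, Thm. 3.3.1, §7.4.1]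
[cite: CastellaGrossiLeeSkinner2022, Thm. 5.1.3] [cite: Wuthrich2014, Lemma 20 (p. 399)]
[cite: Miller2011LMS, Def. 1.1] -/
theorem RowC16.bsdp_of_yzThm49_of_thm331_of_cor54
    (hGZ : ∀ (N : ℕ) [NeZero N] (W : WeierstrassCurve ℚ) (K : Type) [Field K] [NumberField K],
      gross_zagier N W K)
    (hKo : ∀ (N : ℕ) [NeZero N] (W : WeierstrassCurve ℚ) (K : Type) [Field K] [NumberField K],
      kolyvagin N W K)
    (hB : ∀ (N : ℕ) [NeZero N] (W : WeierstrassCurve ℚ) (K : Type) [Field K] [NumberField K],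
      Kolyvagin1990_padicValNat_card_sha_le N W K)
    (hYZ : thm49_charIdeal_eq_padicLFunction_integral)
    (hW20 : Wuthrich2014.lemma20_surjective_threeAdic_of_semistable)
    (h331 : thm331_anticyclotomicControl) (h54 : cor54_prop342_thm513_generator_constantCoeff)
    (hGr : greenberg_charValue_rankZero) (hGZK : rank_eq_analyticRank_of_analyticRank_le_one)
    (hmod : hasEntireLFunction_rat) (hpar : nonempty_modularParametrizationData)
    (hnf : exists_isNewformOf) (hHL : HoffsteinLuo1997_exists_twist_L_one_ne_zero)
    (hMaz : mazur_not_dvd_maninConstant_of_odd) (hNS : integral_neronScaling_of_isGloballyMinimal)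
    (h : RowC16 W p) (hr : W.analyticRank ≤ 1)
    (htam0 : W.analyticRank = 1 → ¬ p ∣ W.tamagawaProduct)
    (hIrrK : W.analyticRank = 1 → ∀ (K : Type) [Field K] [NumberField K], IsImaginaryQuadratic K →
      SatisfiesHeegnerHypothesis (W.conductorNorm ℤ) K → SatisfiesHeegnerHypothesis p K →
      (W.baseChange K).HasIrreducibleModPGaloisRep p) :
    BSDp W p := by
  refine RowC16.bsdp_of_yzThm49_of_thm331 hGZ hKo hB hYZ hW20 h331 hGr hGZK hmod hpar hnf hHL hMaz hNS
    h hr htam0 hIrrK ?_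
  intro hr1 N _ K _ _ Dt H ιC P hN hK hodd hlt hHN hHp _ hP hc hPinf κ hκ γ _ ι
  obtain ⟨hp3, hord, hirr, hsr⟩ := h
  subst hp3
  have hsurj : Surj W 3 := hsr.elim id fun hram ↦ surj_of_irr_of_ram W 3 hirr hram
  have hHN' : SatisfiesHeegnerHypothesis (W.conductorNorm ℤ) K := by rw [hN]; exact hHN
  exact X11b.imcLowerWaldspurgerOnTreeGoodAt_inducedPlace_of_heegner_of_cor54_of_thm331 W 3 N K Dt H
    ιC P h54 h331 (hKo N W K) le_rfl hord (X9.bigIm_three_of_surj W hW20 (Or.inl hord.1) hsurj)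
    (hIrrK hr1 K hK hHN' hHp) hN hK hodd hlt hHN hHp hP hc hPinf hκ ι

/-- **Row C3 at every prime of the row, the whole ORDINARY branch from NAMED LITERATURE FACTS** (+
(irr_K), + `p ∤ ∏c_ℓ`): gen 6 File G2's `RowC3.bsdp_of_thm331_of_thm124b_of_columnMainConjectures`
(ordinary `p ≥ 5`: BCS 1.1.2 (b) + BCS 1.2.4 (b) ∘ CGLS 5.1.3 + JSW 3.3.1) with its last typed binder
on the ordinary branch, `hLA3` (ordinary `p = 3`), DISCHARGED by the re-sourced published fact `h54`
((Im) at `3` from surj(3) — Diamond's refined Serre `RowC3.surj` — by Wuthrich 2014 Lemma 20 `hW20`).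
Supersingular branch unchanged: the typed Kobayashi signed main conjecture (`hKMC`, OPEN in print off
CM / `a_p = 0`) + BKO 2024 Cor. A.5 (`hA5`). The `h54`-twin of gen 7's
`RowC3.bsdp_of_thm331_of_bdpFacts_of_columnMainConjectures`.
[cite: JetchevSkinnerWan2017, Thm. 1.2.1, Thm. 3.3.1] [cite: BurungaleCastellaSkinner2025, Thm. 1.1.2 (b), Thm. 1.2.4 (b)]
[cite: YanZhu2026, Thm. 5.2, Cor. 5.4, proof of Thm. 5.11] [cite: CastellaGrossiSkinner2025, Prop. 3.4.2]
[cite: CastellaGrossiLeeSkinner2022, Thm. 5.1.3] [cite: BurungaleKobayashiOta2023, App. A Cor. A.5]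
[cite: Wuthrich2014, Lemma 20 (p. 399)] -/
theorem RowC3.bsdp_of_thm331_of_bdpFacts_of_cor54_of_columnMainConjectures
    (hGZ : ∀ (N : ℕ) [NeZero N] (W : WeierstrassCurve ℚ) (K : Type) [Field K] [NumberField K],
      gross_zagier N W K)
    (hKo : ∀ (N : ℕ) [NeZero N] (W : WeierstrassCurve ℚ) (K : Type) [Field K] [NumberField K],
      kolyvagin N W K)
    (hB : ∀ (N : ℕ) [NeZero N] (W : WeierstrassCurve ℚ) (K : Type) [Field K] [NumberField K],
      Kolyvagin1990_padicValNat_card_sha_le N W K)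
    (hBCS : thm112b_charIdeal_eq_padicLFunction_integral)
    (hYZ : thm49_charIdeal_eq_padicLFunction_integral)
    (hW20 : Wuthrich2014.lemma20_surjective_threeAdic_of_semistable)
    (h331 : thm331_anticyclotomicControl) (h124 : thm124b_thm513_generator_constantCoeff)
    (h54 : cor54_prop342_thm513_generator_constantCoeff)
    (hA5 : corA5_pPart_of_signedCharIdeal_eq)
    (hGr : greenberg_charValue_rankZero) (hGZK : rank_eq_analyticRank_of_analyticRank_le_one)
    (hmod : hasEntireLFunction_rat) (hpar : nonempty_modularParametrizationData)
    (hnf : exists_isNewformOf) (hLL : diamond1995_refinedSerre)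
    (hHL : HoffsteinLuo1997_exists_twist_L_one_ne_zero)
    (hMaz : mazur_not_dvd_maninConstant_of_odd) (hNS : integral_neronScaling_of_isGloballyMinimal)
    (h : RowC3 W p)
    (htam0 : GoodOrd W p → ¬ p ∣ W.tamagawaProduct)
    (ε : ℤˣ) (hKMC : (p : ℤ) ∣ W.frobeniusTrace p → Supersingular.KobayashiMainConjecture W p ε)
    (hIrrK : GoodOrd W p → ∀ (K : Type) [Field K] [NumberField K], IsImaginaryQuadratic K →
      SatisfiesHeegnerHypothesis (W.conductorNorm ℤ) K → SatisfiesHeegnerHypothesis p K →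
      (W.baseChange K).HasIrreducibleModPGaloisRep p) :
    BSDp W p := by
  refine RowC3.bsdp_of_thm331_of_thm124b_of_columnMainConjectures W p hGZ hKo hB hBCS hYZ hW20 h331 h124
    hA5 hGr hGZK hmod hpar hnf hLL hHL hMaz hNS h htam0 ε hKMC hIrrK ?_
  intro h3 hord N _ K _ _ Dt H ιC P hN hK hodd hlt hHN hHp _ hP hc hPinf κ hκ γ _ ι
  have hsurj : Surj W p := RowC3.surj hnf hLL h
  subst h3
  have hHN' : SatisfiesHeegnerHypothesis (W.conductorNorm ℤ) K := by rw [hN]; exact hHN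
  exact X11b.imcLowerWaldspurgerOnTreeGoodAt_inducedPlace_of_heegner_of_cor54_of_thm331 W 3 N K Dt H
    ιC P h54 h331 (hKo N W K) le_rfl hord (X9.bigIm_three_of_surj W hW20 (Or.inl hord.1) hsurj)
    (hIrrK hord K hK hHN' hHp) hN hK hodd hlt hHN hHp hP hc hPinf hκ ι

end Rows

end Summit.BirchSwinnertonDyer.Rank1Residual

end
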